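import Summits.HubbardSuperconductivity.HubbardSuperconductivity.Theses.ParityGapRigidity
import Literature.MathematicalPhysics.QuantumLattice.HubbardParityGapCeilingStrongCoupling
import HarnessLib

/-!
# Route `ParityGapRigidity` — the parity gap of any window is `O(t)` at strong coupling: `Δ ≤ 2 + 6/√δ`

Crux-facing corollaries of the coupling-independent parity-gap ceiling
`Literature.MathematicalPhysics.QuantumLattice.uniformParityGap_le_of_nonneg` (PG ≤ 4 + 12/√δ for all
large `L`, every `U ≥ 0`, proved with Gutzwiller-projected one-particle trial states: an electron added on
an EMPTY site feels no `U`, and removing one never raises the repulsion) for the two undecided items of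
the route that speak about the parity gap — complementing `Theorems/ParityGapRigidityParityGapCeiling`
(`Δ ≤ 2U/√(1-δ)`, void as `U → ∞`):

* `gappedWindow_gap_le_strongCoupling` — every `(U, δ, Δ, L₀)` satisfying the parity-gap clause (PG) of
  the crux `GappedWindow` (stmt-HubbardSuperconductivity-2196; clause verbatim) has `Δ ≤ 2 + 6/√δ`,
  WHATEVER `U > 0` is; `gappedWindow_gap_le_min` — together with the `O(U)` ceiling,
  `Δ ≤ min (2U/√(1-δ)) (2 + 6/√δ)`; `gappedWindow_gap_le_twelve` — for `δ ≥ 9/25` (containing the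
  Kohn–Luttinger candidate `δ ≈ 0.4`) this is the pure number `Δ ≤ 12` for all `U` (at `δ = 0.4`:
  `Δ ≤ 11.5`, and `Δ ≤ 2.6·U` below `U ≈ 4.4`); `gappedWindow_imp_exists_bounded_gap` — the crux BY NAME
  implies a window whose gap obeys both ceilings;
* `noUniformParityGap_above_strongCouplingCeiling` — the kill criterion `NoUniformParityGap`
  (stmt-HubbardSuperconductivity-2198) HOLDS for every gap above `2 + 6/√δ` at EVERY `U > 0`: what remains
  open of it is exactly the band `0 < Δ ≤ min(2U/√(1-δ), 2 + 6/√δ)`.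

Reading for the crux: a window of the pure repulsive model cannot be a strong-coupling (Mott-scale) effect —
its one-particle gap is bounded by hopping data alone; the only way to a large parity gap, half filling, is
outside `δ ∈ (0, 1/2)`.  Sources: as in the Literature files (Tasaki 2020 §2.1, §9.3, §11.2;
Brinkman–Rice 1970; Matveev–Larkin 1997). [folklore]
-/

-- the mandated namespace `Summit.<Summit>.<Problem>.Theorems` repeats `HubbardSuperconductivity`
-- (single-problem summit, D-0017), which the `dupNamespace` linter flags on every declaration
set_option linter.dupNamespace false

noncomputable section

namespace Summit.HubbardSuperconductivity.HubbardSuperconductivity.Theorems.ParityGapRigidityStrongCoupling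

open Literature.MathematicalPhysics.QuantumLattice

/-- **Every witness of the parity-gap clause of `GappedWindow` has `Δ ≤ 2 + 6/√δ`, whatever the coupling.**
For `U > 0`, `δ ∈ (0, 1/2)`, `Δ` and `L₀` with `2Δ ≤ E(N_L+1) + E(N_L-1) - 2E₀(N_L, S^z=0)` for all even
`L ≥ L₀` (the first conjunct of `Theses.ParityGapRigidity.GappedWindow`, verbatim): `Δ ≤ 2 + 6/√δ`
(`uniformParityGap_le_of_nonneg`: projected one-particle trial states). [folklore] -/
theorem gappedWindow_gap_le_strongCoupling (U δ Δ : ℝ) (L₀ : ℕ) (hU : 0 < U)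
    (hδ : δ ∈ Set.Ioo (0 : ℝ) (1 / 2))
    (h : ∀ L ≥ L₀, Even L → ∀ Hm, Hm = Literature.MathematicalPhysics.QuantumLattice.hubbardTorus 2 L 1 U → 2 * Δ ≤ Literature.MathematicalPhysics.QuantumLattice.groundEnergy Hm (2 * ⌊(1 - δ) * (L : ℝ) ^ 2 / 2⌋₊ + 1) + Literature.MathematicalPhysics.QuantumLattice.groundEnergy Hm (2 * ⌊(1 - δ) * (L : ℝ) ^ 2 / 2⌋₊ - 1) - 2 * Matrix.minEnergyOn Hm (Literature.MathematicalPhysics.QuantumLattice.szSector (2 * ⌊(1 - δ) * (L : ℝ) ^ 2 / 2⌋₊) 0)) :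
    Δ ≤ 2 + 6 / Real.sqrt δ :=
  uniformParityGap_le_of_nonneg hU.le hδ.1 (by linarith [hδ.2]) h

/-- **Both ceilings**: every witness of the parity-gap clause of `GappedWindow` has
`Δ ≤ min (2U/√(1-δ)) (2 + 6/√δ)` — `O(U)` at weak coupling, `O(t)` at strong coupling. [folklore] -/
theorem gappedWindow_gap_le_min (U δ Δ : ℝ) (L₀ : ℕ) (hU : 0 < U) (hδ : δ ∈ Set.Ioo (0 : ℝ) (1 / 2))
    (h : ∀ L ≥ L₀, Even L → ∀ Hm, Hm = Literature.MathematicalPhysics.QuantumLattice.hubbardTorus 2 L 1 U → 2 * Δ ≤ Literature.MathematicalPhysics.QuantumLattice.groundEnergy Hm (2 * ⌊(1 - δ) * (L : ℝ) ^ 2 / 2⌋₊ + 1) + Literature.MathematicalPhysics.QuantumLattice.groundEnergy Hm (2 * ⌊(1 - δ) * (L : ℝ) ^ 2 / 2⌋₊ - 1) - 2 * Matrix.minEnergyOn Hm (Literature.MathematicalPhysics.QuantumLattice.szSector (2 * ⌊(1 - δ) * (L : ℝ) ^ 2 / 2⌋₊) 0)) :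
    Δ ≤ min (2 * U / Real.sqrt (1 - δ)) (2 + 6 / Real.sqrt δ) := by
  have h1 := uniformParityGap_le_min hU.le hδ.1 (by linarith [hδ.2]) h
  rwa [abs_of_pos hU] at h1

/-- **A pure number at the candidate doping**: if moreover `δ ≥ 9/25` (a range containing the
Kohn–Luttinger candidate `δ ≈ 0.4` of the crux) then `Δ ≤ 12` hopping units for EVERY coupling `U > 0`
(`√δ ≥ 3/5`, so `6/√δ ≤ 10`). [folklore] -/
theorem gappedWindow_gap_le_twelve (U δ Δ : ℝ) (L₀ : ℕ) (hU : 0 < U) (hδ : δ ∈ Set.Ioo (0 : ℝ) (1 / 2))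
    (hδ9 : (9 : ℝ) / 25 ≤ δ)
    (h : ∀ L ≥ L₀, Even L → ∀ Hm, Hm = Literature.MathematicalPhysics.QuantumLattice.hubbardTorus 2 L 1 U → 2 * Δ ≤ Literature.MathematicalPhysics.QuantumLattice.groundEnergy Hm (2 * ⌊(1 - δ) * (L : ℝ) ^ 2 / 2⌋₊ + 1) + Literature.MathematicalPhysics.QuantumLattice.groundEnergy Hm (2 * ⌊(1 - δ) * (L : ℝ) ^ 2 / 2⌋₊ - 1) - 2 * Matrix.minEnergyOn Hm (Literature.MathematicalPhysics.QuantumLattice.szSector (2 * ⌊(1 - δ) * (L : ℝ) ^ 2 / 2⌋₊) 0)) :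
    Δ ≤ 12 := by
  have h1 := gappedWindow_gap_le_strongCoupling U δ Δ L₀ hU hδ h
  -- `√δ ≥ 3/5`, so `6/√δ ≤ 10`
  have hs : (3 : ℝ) / 5 ≤ Real.sqrt δ := by
    rw [show (3 : ℝ) / 5 = Real.sqrt ((3 / 5) ^ 2) by rw [Real.sqrt_sq (by norm_num)]]
    exact Real.sqrt_le_sqrt (by nlinarith)
  have hpos : (0 : ℝ) < 3 / 5 := by norm_num
  have h6 : 6 / Real.sqrt δ ≤ 6 / (3 / 5 : ℝ) := div_le_div_of_nonneg_left (by norm_num) hpos hs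
  linarith [show (6 : ℝ) / (3 / 5) = 10 by norm_num]

/-- **The kill criterion holds above the strong-coupling ceiling, at every coupling.** For every `U > 0`,
`δ ∈ (0, 1/2)` and every `Δ > 2 + 6/√δ` there are NO `L₀` with
`2Δ ≤ E(N_L+1) + E(N_L-1) - 2E₀(N_L, S^z=0)` for all even `L ≥ L₀`:
`Theses.ParityGapRigidity.NoUniformParityGap` restricted to gaps above `2 + 6/√δ` is a theorem; with
`Theorems/ParityGapRigidityParityGapCeiling.noUniformParityGap_above_ceiling` its open content is the band
`0 < Δ ≤ min(2U/√(1-δ), 2 + 6/√δ)`. [folklore] -/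
theorem noUniformParityGap_above_strongCouplingCeiling :
    ∀ (U δ : ℝ), 0 < U → δ ∈ Set.Ioo (0 : ℝ) (1 / 2) → ∀ Δ : ℝ, 2 + 6 / Real.sqrt δ < Δ →
      ¬ ∃ L₀ : ℕ, ∀ L ≥ L₀, Even L → ∀ Hm, Hm = Literature.MathematicalPhysics.QuantumLattice.hubbardTorus 2 L 1 U → 2 * Δ ≤ Literature.MathematicalPhysics.QuantumLattice.groundEnergy Hm (2 * ⌊(1 - δ) * (L : ℝ) ^ 2 / 2⌋₊ + 1) + Literature.MathematicalPhysics.QuantumLattice.groundEnergy Hm (2 * ⌊(1 - δ) * (L : ℝ) ^ 2 / 2⌋₊ - 1) - 2 * Matrix.minEnergyOn Hm (Literature.MathematicalPhysics.QuantumLattice.szSector (2 * ⌊(1 - δ) * (L : ℝ) ^ 2 / 2⌋₊) 0) := by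
  rintro U δ hU hδ Δ hΔ ⟨L₀, h⟩
  have h1 := gappedWindow_gap_le_strongCoupling U δ Δ L₀ hU hδ h
  linarith

/-- **The crux's gap is at most `2 + 6/√δ`**: `GappedWindow` (the whole crux, by name) implies the
existence of a window whose parity gap obeys BOTH ceilings — a necessary condition any proof of the crux
must meet and any refutation may assume. [folklore] -/
theorem gappedWindow_imp_exists_bounded_gap
    (hW : Summit.HubbardSuperconductivity.HubbardSuperconductivity.Theses.ParityGapRigidity.GappedWindow) :
    ∃ U : ℝ, 0 < U ∧ ∃ δ ∈ Set.Ioo (0 : ℝ) (1 / 2), ∃ Δ : ℝ, 0 < Δ ∧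
      Δ ≤ min (2 * U / Real.sqrt (1 - δ)) (2 + 6 / Real.sqrt δ) ∧
      ∃ L₀ : ℕ, ∀ L ≥ L₀, Even L → ∀ Hm, Hm = Literature.MathematicalPhysics.QuantumLattice.hubbardTorus 2 L 1 U → 2 * Δ ≤ Literature.MathematicalPhysics.QuantumLattice.groundEnergy Hm (2 * ⌊(1 - δ) * (L : ℝ) ^ 2 / 2⌋₊ + 1) + Literature.MathematicalPhysics.QuantumLattice.groundEnergy Hm (2 * ⌊(1 - δ) * (L : ℝ) ^ 2 / 2⌋₊ - 1) - 2 * Matrix.minEnergyOn Hm (Literature.MathematicalPhysics.QuantumLattice.szSector (2 * ⌊(1 - δ) * (L : ℝ) ^ 2 / 2⌋₊) 0) := by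
  obtain ⟨U, hU, δ, hδ, ⟨Δ, hΔ, L₀, hPG⟩, -⟩ := hW
  exact ⟨U, hU, δ, hδ, Δ, hΔ, gappedWindow_gap_le_min U δ Δ L₀ hU hδ hPG, L₀, hPG⟩

end Summit.HubbardSuperconductivity.HubbardSuperconductivity.Theorems.ParityGapRigidityStrongCoupling

end
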